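import Summits.QuantumFields.YangMills.Theorems.BalabanUVNodesN19SingleModeLowerBound

/-!
# YM-DAG node N19 (= NE7 proper) — THE LOWER SIDE OF THE KINK, PART 4: the COSINE face of the single mode in the oscillating regime —
# `dist_∞(cos(ωΣ_{i≤d}|x_i|), Π_t) ≥ ω⌊d∕2⌋∕(20πt)` for `π ≤ ωd ≤ t∕5`

Cell `pub-ymgap`, HUMAN RULING D-0062 (Track A) ∕ D-0149 (work-bound push), R141 (C) wider-strategy seat `pub-ymgap-dag-n19-e` (strategy
s3 = ALTERNATIVE CURRENCY), generation g31, module 4 (lineage module 135).  Route `Summits/QuantumFields/YangMills/Theses/BalabanUVNodes.lean`,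
cluster item K3⁸ «SpineGivenEndpointR13SepCoPHV» (stmt-QuantumFields-27366); filed `--supports` that item `--as helper` (it proves no registered
stub).  COUNT-NEUTRAL: [folklore] over PART 3 `…N19SingleModeLowerBound` BY NAME (`exists_le_abs_sin_mul_abs_sub_eval`,
`exists_polynomial_restrictLine`, `sum_abs_lineConfig`); no laws, no scheme object, no Theses import; NOT a discharge claim.

CONTENT.  Along the full diagonal `cos(ωd|s|) = cos(ωds)` is real-analytic, so PART 3 claimed no lower bound for the cosine face.  But on a
PARTIAL diagonal with `k` moving coordinates and frozen ℓ¹-mass EXACTLY A QUARTER PERIOD, `c = π∕(2ω)` (available as soon as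
`π∕(2ω) ≤ d − k`), the phase shift turns the cosine into a kinked sine: `cos(ω(k|s| + π∕(2ω))) = cos(ωk|s| + π∕2) = −sin(ωk|s|)`, and PART 3's
one-dimensional theorem applies to the polynomial `−p`:
★★ `exists_le_abs_cos_l1Norm_sub_eval` — for `t ≥ 6`, `ω > 0`, `k ≤ |ι|` with `ωk ≤ t∕10` and `π∕(2ω) ≤ |ι| − k`, every `P : MvPolynomial ι ℝ`
of total degree `≤ t` misses `cos(ωΣ_i|x_i|)` by `≥ ωk∕(20πt)` somewhere on `[−1,1]^ι`;
★★ `exists_le_abs_cos_l1Norm_sub_eval_of_pi_le` — the OSCILLATING REGIME `π ≤ ω|ι| ≤ t∕5`: `≥ ω⌊|ι|∕2⌋∕(20πt)` (`k = ⌊|ι|∕2⌋`).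
READING (HOME `CURRENCY-MAP.md`): both real faces of the single mode `e^{iωS_d}` are now two-sided up to `log²t` in the oscillating window
`π ≤ ωd ≲ t`; for `ωd < π` the cosine face is genuinely smoother along every line through the cube's kinks only to second order
(`cos(ωS) = 1 − ω²S²∕2 + …`, `S² = Σx_i² + 2Σ_{i<j}|x_i||x_j|`) and no `≍ ωd∕t` bound is claimed there.

HONEST FRAMING (binding).  Elementary and [folklore]; NO consumer in the DAG today (an optimality map of the seat's own currency, degree model);
nothing of Bałaban's instantiated; NE7 NOT PRINTED, NOT proved; N19 NOT discharged; count-neutral.  One finite `T⁴` programme at fixed `ε`;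
nothing continuum ∕ `ℝ⁴` ∕ OS ∕ mass-gap ∕ Clay.  Constants not optimised.  0 `def` ∕ 0 `sorry`.
-/

noncomputable section

open Finset Real Polynomial

namespace Summit.QuantumFields.YangMills.Theorems.BalabanUVNodesN19CosModeLowerBound

open Summit.QuantumFields.YangMills.Theorems.BalabanUVNodesN19SingleModeLowerBound
  (exists_le_abs_sin_mul_abs_sub_eval exists_polynomial_restrictLine sum_abs_lineConfig)

variable {ι : Type*} [Fintype ι] [DecidableEq ι]

/-- ★★ **THE COSINE FACE, quarter-period frozen mass.**  For `t ≥ 6`, `ω > 0`, `k ≤ |ι|` with `ωk ≤ t∕10` and `π∕(2ω) ≤ |ι| − k`, and every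
`P : MvPolynomial ι ℝ` of total degree `≤ t`, there is `x ∈ [−1,1]^ι` with `|cos(ωΣ_i|x_i|) − P(x)| ≥ ωk∕(20πt)` (`k` coordinates equal to
`s`, the other `|ι| − k` frozen at the common height `π∕(2ω(|ι| − k))`; along this line `cos(ωΣ_i|x_i|) = −sin(ωk|s|)`). [folklore] -/
theorem exists_le_abs_cos_l1Norm_sub_eval {t : ℕ} (ht : 6 ≤ t) {ω : ℝ} (hω : 0 < ω) {k : ℕ} (hk : k ≤ Fintype.card ι)
    (hωk : ω * k ≤ t / 10) (hroom : π / (2 * ω) ≤ Fintype.card ι - k) (P : MvPolynomial ι ℝ)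
    (hP : P.totalDegree ≤ t) :
    ∃ x : ι → ℝ, (∀ i, x i ∈ Set.Icc (-1 : ℝ) 1) ∧
      ω * k / (20 * π * t) ≤ |Real.cos (ω * ∑ i, |x i|) - MvPolynomial.eval x P| := by
  obtain ⟨A, -, hA⟩ := Finset.exists_subset_card_eq (s := (Finset.univ : Finset ι)) (n := k)
    (by simpa [Finset.card_univ] using hk)
  -- the frozen height `b = π/(2ω(|ι| − k)) ∈ (0, 1]`
  have hquarter : 0 < π / (2 * ω) := by positivity
  have hpos : (0 : ℝ) < (Fintype.card ι : ℝ) - k := lt_of_lt_of_le hquarter hroom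
  set b : ℝ := π / (2 * ω) / ((Fintype.card ι : ℝ) - k) with hb
  have hb0 : 0 ≤ b := div_nonneg hquarter.le hpos.le
  have hb1 : b ≤ 1 := by rw [hb, div_le_one hpos]; exact hroom
  have hbmass : ((Fintype.card ι : ℝ) - k) * b = π / (2 * ω) := mul_div_cancel₀ _ hpos.ne'
  set x₀ : ι → ℝ := fun i => if i ∈ A then 0 else b with hx₀
  set v : ι → ℝ := fun i => if i ∈ A then 1 else 0 with hv
  obtain ⟨p, hpdeg, hpev⟩ := exists_polynomial_restrictLine P x₀ v
  have hndeg : (-p).natDegree ≤ t := by rw [Polynomial.natDegree_neg]; exact hpdeg.trans hP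
  obtain ⟨s, hs, h⟩ := exists_le_abs_sin_mul_abs_sub_eval ht (mul_nonneg hω.le (Nat.cast_nonneg k)) hωk (-p) hndeg
  refine ⟨fun i => x₀ i + s * v i, fun i => ?_, ?_⟩
  · simp only [hx₀, hv]
    split_ifs
    · simpa using hs
    · simp only [mul_zero, add_zero, Set.mem_Icc]
      exact ⟨by linarith, hb1⟩
  have hsum : ∑ i, |x₀ i + s * v i| = k * |s| + π / (2 * ω) := by
    simp only [hx₀, hv]
    rw [sum_abs_lineConfig A hb0 s, hA, hbmass]
  have hphase : Real.cos (ω * (k * |s| + π / (2 * ω))) = -Real.sin (ω * k * |s|) := by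
    rw [show ω * (k * |s| + π / (2 * ω)) = ω * k * |s| + π / 2 by field_simp, Real.cos_add_pi_div_two]
  rw [hsum, ← hpev s, hphase]
  rw [Polynomial.eval_neg] at h
  calc ω * k / (20 * π * t) ≤ |Real.sin (ω * k * |s|) - -p.eval s| := h
    _ = |-Real.sin (ω * k * |s|) - p.eval s| := by
        rw [← abs_neg]
        ring_nf

/-- ★★ **THE COSINE FACE IN THE OSCILLATING REGIME.**  For `t ≥ 6`, `ω > 0` with `π ≤ ω|ι| ≤ t∕5` and every `P : MvPolynomial ι ℝ` of
total degree `≤ t` there is `x ∈ [−1,1]^ι` with `|cos(ωΣ_i|x_i|) − P(x)| ≥ ω⌊|ι|∕2⌋∕(20πt)` (the previous theorem with `k = ⌊|ι|∕2⌋`: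
`|ι| − k ≥ |ι|∕2 ≥ π∕(2ω)` and `ωk ≤ ω|ι|∕2 ≤ t∕10`). [folklore] -/
theorem exists_le_abs_cos_l1Norm_sub_eval_of_pi_le {t : ℕ} (ht : 6 ≤ t) {ω : ℝ} (hω : 0 < ω)
    (hlow : π ≤ ω * Fintype.card ι) (hhigh : ω * Fintype.card ι ≤ t / 5) (P : MvPolynomial ι ℝ)
    (hP : P.totalDegree ≤ t) :
    ∃ x : ι → ℝ, (∀ i, x i ∈ Set.Icc (-1 : ℝ) 1) ∧
      ω * ((Fintype.card ι / 2 : ℕ) : ℝ) / (20 * π * t) ≤ |Real.cos (ω * ∑ i, |x i|) - MvPolynomial.eval x P| := by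
  set d : ℕ := Fintype.card ι with hd
  have hk : d / 2 ≤ d := Nat.div_le_self d 2
  have hk2 : 2 * (((d / 2 : ℕ)) : ℝ) ≤ d := by
    have : 2 * (d / 2) ≤ d := Nat.mul_div_le d 2
    exact_mod_cast this
  have hωk : ω * ((d / 2 : ℕ) : ℝ) ≤ t / 10 := by nlinarith
  have hroom : π / (2 * ω) ≤ (d : ℝ) - (d / 2 : ℕ) := by
    rw [div_le_iff₀ (by positivity)]
    nlinarith
  exact exists_le_abs_cos_l1Norm_sub_eval ht hω hk hωk hroom P hP

/-! ## v1.1 (g31, append-only): the complex pair, module 122's form [folklore] -/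

omit [DecidableEq ι] in
/-- ★★ **THE LOWER SIDE IN MODULE 122's FORM.**  For `t ≥ 6`, `ω ≥ 0` with `ω|ι| ≤ t∕10` and every PAIR of real `MvPolynomial`s `Cr, Ci`
with `Ci` of total degree `≤ t`, somewhere on `[−1,1]^ι` one has `‖Cr(x) + Ci(x)·i − e^{iωΣ_i|x_i|}‖ ≥ ω|ι|∕(20πt)` (the imaginary part is
PART 3's sine face; module 122: `≤ 300·log₂t·(log₂t + 4ω|ι|)∕t` for a suitable pair of total degree `≤ t`). [folklore] -/
theorem exists_le_norm_pair_sub_cexp_l1Norm {t : ℕ} (ht : 6 ≤ t) {ω : ℝ} (hω : 0 ≤ ω)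
    (hωd : ω * Fintype.card ι ≤ t / 10) (Cr Ci : MvPolynomial ι ℝ) (hCi : Ci.totalDegree ≤ t) :
    ∃ x : ι → ℝ, (∀ i, x i ∈ Set.Icc (-1 : ℝ) 1) ∧
      ω * Fintype.card ι / (20 * π * t) ≤
        ‖((MvPolynomial.eval x Cr : ℝ) : ℂ) + ((MvPolynomial.eval x Ci : ℝ) : ℂ) * Complex.I -
          Complex.exp (((ω * ∑ i, |x i| : ℝ) : ℂ) * Complex.I)‖ := by
  classical
  obtain ⟨x, hx, h⟩ :=
    Summit.QuantumFields.YangMills.Theorems.BalabanUVNodesN19SingleModeLowerBound.exists_le_abs_sin_l1Norm_sub_eval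
      ht hω hωd Ci hCi
  refine ⟨x, hx, h.trans ?_⟩
  have him : (((MvPolynomial.eval x Cr : ℝ) : ℂ) + ((MvPolynomial.eval x Ci : ℝ) : ℂ) * Complex.I -
      Complex.exp (((ω * ∑ i, |x i| : ℝ) : ℂ) * Complex.I)).im =
      MvPolynomial.eval x Ci - Real.sin (ω * ∑ i, |x i|) := by
    simp only [Complex.sub_im, Complex.add_im, Complex.mul_im, Complex.ofReal_re, Complex.ofReal_im, Complex.I_re,
      Complex.I_im, Complex.exp_ofReal_mul_I_im, mul_zero, mul_one, zero_add, add_zero]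
  calc |Real.sin (ω * ∑ i, |x i|) - MvPolynomial.eval x Ci|
      = |(((MvPolynomial.eval x Cr : ℝ) : ℂ) + ((MvPolynomial.eval x Ci : ℝ) : ℂ) * Complex.I -
          Complex.exp (((ω * ∑ i, |x i| : ℝ) : ℂ) * Complex.I)).im| := by rw [him, abs_sub_comm]
    _ ≤ _ := Complex.abs_im_le_norm _

end Summit.QuantumFields.YangMills.Theorems.BalabanUVNodesN19CosModeLowerBound

end
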